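import Literature.IUT.HodgeArakelov.GaloisPairRigidity
import Literature.IUT.HodgeArakelov.AbsTopMonoidsGaloisPairBridge
import Literature.AnabelianGeometry.AbsoluteAnabelian.MonoidKummerMaps

/-!
# [IUTchII] Rmk 1.11.1 (i) (a) — DISCHARGE of `Rmk1111_a` from the mono-analytic lifting facts of [AbsTopIII]

Proof-only companion (0 definitions) to the landed `GaloisPairRigidity.lean` (p409065, abc-iut-L6-t1) over the
bridge `AbsTopMonoidsGaloisPairBridge.lean` (abc-iut-L6-t7, B9 (a)) and abc-iut-L4-t2's `MonoidKummerMaps.lean`.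
S. Mochizuki, *Inter-universal Teichmüller theory II*, kurims manuscript (Dec. 2020), Rmk. 1.11.1 (i) (a) p. 50:
"the group of automorphisms of the … MLF-Galois `TM`-pair … `G ↷ O^⊳(G)` maps bijectively [i.e., by forgetting
`O^⊳(G)`] onto the group of automorphisms of the topological group `G` [cf. [AbsTopIII], Proposition 3.2,
(iv)]". The landed named fact is `Rmk1111_a A`. AUTHOR-ERRATA register E-11 / G15-1 (abc-iut-L6-t23): the
cited [AbsTopIII] Prop. 3.2 (iv), as corrected by the author's *Comments* (Jun 2019) item (5), covers only
pairs of hyperbolic-orbicurve type; the MONO-ANALYTIC case used here is [IUTchII]'s own assertion, typed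
upstream (abc-iut-L4-t2, p411034) as the named facts `GaloisIsoLiftsToTMPairIsoOfMonoAnalytic` (every
isomorphism of topological groups lifts to an isomorphism of pairs) and `PairIsoDeterminedByGalois`
([AbsTopIII] Prop. 3.2 (iv) injectivity: the lift is unique). HERE: `Rmk1111_a A` FOLLOWS from those two
facts, over the merged reading `AbsTopMonoids.IsTMPair` ("`G ↷ O^⊳(G)` IS an MLF-Galois `TM`-pair") and the
mono-analytic type of the pairs (`IsOfMonoAnalyticTypeMonoid .TM`); both conditions need only be checked at ONE
object of the connected groupoid `IsoClass G_k` (`…_of_exists`). Nothing is asserted: the two [AbsTopIII]/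
[IUTchII] facts remain hypotheses BY NAME (conditional discharge; D-0026: the L6 fact `Rmk1111_a` is reduced to
the L4 facts). Claim key `Mochizuki2012` (D-0012, disputed); no side taken on [IUTchIII] Cor. 3.12.
-/

namespace Literature.IUT.HodgeArakelov

open CategoryTheory
open Literature.AnabelianGeometry.AbsoluteAnabelian

variable {S : ThetaSetting.{0}} (A : AbsTopMonoids S) (hA : A.ContinuityLaws)

/-- "Of mono-analytic type" (for `TM`-pairs) is invariant under isomorphisms of pairs (it is defined as
"isomorphic to a mono-analytic model pair"). [cite: MochizukiAbsTopIII2015, Definition 3.1 (ii) p.67] -/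
theorem isOfMonoAnalyticTypeMonoid_of_iso {T : PairType} {P Q : GaloisMonoidPair.{0}}
    (e : GaloisMonoidPair.Iso P Q) (hP : IsOfMonoAnalyticTypeMonoid T P) : IsOfMonoAnalyticTypeMonoid T Q := by
  obtain ⟨C, D, R, hD, hR, ⟨i⟩⟩ := hP.exists_model
  exact ⟨C, D, R, hD, hR, ⟨AbsTopMonoids.pairIsoTrans i e⟩⟩

/-- The mono-analytic type of `G ↷ O^⊳(G)` holds at every `G ≅ G_k` as soon as it holds at one (transport
along `mapPairIso`; `IsoClass` is connected). [cite: Mochizuki2012, Ex 1.8 (ii) p.36] -/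
theorem isOfMonoAnalyticType_toPair_forall_of_exists
    (h : ∃ G, IsOfMonoAnalyticTypeMonoid .TM (A.toPair hA G)) (H : IsoClass S.Gk) :
    IsOfMonoAnalyticTypeMonoid .TM (A.toPair hA H) := by
  obtain ⟨G, hG⟩ := h
  obtain ⟨f⟩ := IsoClass.nonempty_hom G H
  exact isOfMonoAnalyticTypeMonoid_of_iso (A.mapPairIso hA f) hG

/-- **IUTchII:Rmk1.11.1(i)** (a) DISCHARGED modulo the [AbsTopIII]/[IUTchII] lifting facts (kurims p. 50):
if `G ↷ O^⊳(G)` is an MLF-Galois `TM`-pair of mono-analytic type (at every `G ≅ G_k`), then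
`GaloisIsoLiftsToTMPairIsoOfMonoAnalytic` (every `G ≅ G` lifts) and `PairIsoDeterminedByGalois` (the lift is
unique) give the printed bijection `Aut(G ↷ O^⊳(G)) → Aut(G)`, i.e. `Rmk1111_a A`.
[cite: Mochizuki2012, Rmk 1.11.1 (i) p.50] -/
theorem Rmk1111_a_of_monoAnalyticLifts (hTM : ∀ G, A.IsTMPair hA G)
    (hMA : ∀ G, IsOfMonoAnalyticTypeMonoid .TM (A.toPair hA G))
    (hlift : GaloisIsoLiftsToTMPairIsoOfMonoAnalytic) (hdet : PairIsoDeterminedByGalois) : Rmk1111_a A := by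
  intro G
  constructor
  · -- injectivity: the `O^⊳(G)`-component is determined by the `G`-component ([AbsTopIII] Prop 3.2 (iv))
    intro p q hpq
    have hpq' : p.1.1 = q.1.1 := hpq
    have hp : ∀ (g : G.G) (m : A.Otri G),
        p.1.2 (A.actOtri G g m) = A.actOtri G (IsoClass.homIso p.1.1.hom g) (p.1.2 m) := p.2
    have hq : ∀ (g : G.G) (m : A.Otri G),
        q.1.2 (A.actOtri G g m) = A.actOtri G (IsoClass.homIso q.1.1.hom g) (q.1.2 m) := q.2
    -- a `PairAut` element IS an isomorphism of [AbsTopIII] pairs `toPair G ≅ toPair G`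
    let ep : GaloisMonoidPair.Iso (A.toPair hA G) (A.toPair hA G) :=
      ⟨IsoClass.homIso p.1.1.hom, p.1.2, fun g m => hp g m⟩
    let eq' : GaloisMonoidPair.Iso (A.toPair hA G) (A.toPair hA G) :=
      ⟨IsoClass.homIso q.1.1.hom, q.1.2, fun g m => hq g m⟩
    have hM : ep.isoM = eq'.isoM :=
      hdet _ _ (hTM G) (hTM G) ep eq' (by change IsoClass.homIso p.1.1.hom = IsoClass.homIso q.1.1.hom; rw [hpq'])
    exact Subtype.ext (Prod.ext hpq' hM)
  · -- surjectivity: every automorphism of `G` lifts ([IUTchII] Rmk 1.11.1 (i)(a) / [AbsTopIII] Cor 1.10)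
    intro σ
    obtain ⟨e, he⟩ := hlift _ _ (hTM G) (hTM G) (hMA G) (hMA G) (IsoClass.homIso σ.hom)
    refine ⟨⟨(σ, e.isoM), fun g m => ?_⟩, rfl⟩
    have h := e.smul_comm g m
    rw [he] at h
    exact h

/-- **IUTchII:Rmk1.11.1(i)** (a), the same with the two side conditions checked at ONE object of `IsoClass G_k`
(e.g. the reference `G_k` itself), by connectedness. [cite: Mochizuki2012, Rmk 1.11.1 (i) p.50] -/
theorem Rmk1111_a_of_monoAnalyticLifts_of_exists (hTM : ∃ G, A.IsTMPair hA G)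
    (hMA : ∃ G, IsOfMonoAnalyticTypeMonoid .TM (A.toPair hA G))
    (hlift : GaloisIsoLiftsToTMPairIsoOfMonoAnalytic) (hdet : PairIsoDeterminedByGalois) : Rmk1111_a A :=
  Rmk1111_a_of_monoAnalyticLifts A hA (A.isTMPair_forall_of_exists hA hTM)
    (isOfMonoAnalyticType_toPair_forall_of_exists A hA hMA) hlift hdet

end Literature.IUT.HodgeArakelov
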